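import Mathlib
import HarnessLib
import HarnessLib.Audit
import Summits.ResolutionOfSingularities.ResolutionOfSingularities.Theses.WeightedInvariant
import Literature.AlgebraicGeometry.Resolution.CobordantChartCoefficients

/-!
# Crux `LocalWeightedDrop` — line `vertex-descent-weight-residues` (lead's skeleton, reshaped)

Crux item stmt-ResolutionOfSingularities-8899, route ResolutionOfSingularities/WeightedInvariant.

Composition idea (the planner's line, reconstructed from the ledger's stub registry — the planner's file is not
readable from the lead's jail): ONE ordinal rank `ρ` on formal germs in all embedding dimensions which is monotone
under formal coordinate changes, multiplication by units and passage to a cylinder, and which after SOME weighted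
cobordant move drops at every off-vertex singular successor — measured on the `n`-variable flat SLICE `g|_{yᵢ=0}` at a
TAME coordinate (`cᵢ ≠ 0`, `p ∤ wᵢ`) and on the honest `(n+1)`-variable successor at WILD points (all `wᵢ` with
`cᵢ ≠ 0` divisible by `p`), where the successor carries the `μ_D`-grading descended from the vertex
(`stub_gradingDescent`).  The crux's `ι` is `ρ` itself: at a tame point the successor is a unit times a coordinate
change of the cylinder over its slice (TAME SLICE = Luna's étale slice for the `G_m`-action on Włodarczyk's `B₊`;
here cut into `stub_unitRoot` + `stub_tameSliceKappa` + `stub_sliceCyl`), so the three monotonicities carry the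
slice drop up to `g`.

Stubs (registered): `stub_gradingDescent` [S], `stub_unitRoot` [S], `stub_sliceCyl` [S], `stub_tameSliceKappa` [M/L],
`stub_hornedRank` [XL, hardest — the lead's].  Everything else in this file is sorry-free.
-/

set_option linter.dupNamespace false -- `Summit.ResolutionOfSingularities.ResolutionOfSingularities` is the mandated namespace of this single-conjunct summit (lakefile weak option)

namespace Summit.ResolutionOfSingularities.ResolutionOfSingularities.Theorems.LocalWeightedDropLine

open Literature.AlgebraicGeometry.Resolution

/-! ## Registered stubs -/

/-- GRADING DESCENT (vertex ⇒ every exceptional point).  In the factorisation `F(s^w(c+y)) = sᵃ·g` at an exceptional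
point `c` (convention `cᵢ = 0` when `wᵢ = 0`), every monomial `s^r y^β` of `g` satisfies `w·β ≡ a + r (mod D)` for
every `D` dividing all `wᵢ` with `cᵢ ≠ 0`: the torus grading of the vertex successor descends to a `ℤ/D`-grading. -/
theorem stub_gradingDescent : ∀ (k : Type) [Field k] (n : ℕ) (F : MvPowerSeries (Fin n) k) (w : Fin n → ℕ)
    (c : Fin n → k), (∀ i, w i = 0 → c i = 0) → ∀ (a : ℕ) (g : MvPowerSeries (Fin (n + 1)) k),
    MvPowerSeries.subst (CobordantChart.chart w c) F = MvPowerSeries.X 0 ^ a * g →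
    ∀ D : ℕ, (∀ i, c i ≠ 0 → D ∣ w i) → ∀ e : Fin (n + 1) →₀ ℕ, MvPowerSeries.coeff e g ≠ 0 →
    Finsupp.weight w (Finsupp.tail e) ≡ a + e 0 [MOD D] := by
  sorry

/-- UNIT ROOT.  Over a field in which `m ≠ 0`, the 1-unit `1 + c⁻¹·X_j` has an `m`-th root `r ≡ 1 (mod X_j)` which is a
power series in the single variable `X_j`. -/
theorem stub_unitRoot : ∀ (k : Type) [Field k] (n : ℕ) (j : Fin (n + 1)) (m : ℕ), (m : k) ≠ 0 → ∀ (c : k), c ≠ 0 →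
    ∃ r : MvPowerSeries (Fin (n + 1)) k, MvPowerSeries.constantCoeff r = 1 ∧
      r ^ m = 1 + MvPowerSeries.C c⁻¹ * MvPowerSeries.X j ∧
      ∀ e : Fin (n + 1) →₀ ℕ, MvPowerSeries.coeff e r ≠ 0 → ∀ l, l ≠ j → e l = 0 := by
  sorry

/-- SLICE-THEN-CYLINDER = KILLING `yᵢ`.  Restricting `g(s,y)` to the slice `yᵢ = 0` (renumbered to `n` variables) and
re-embedding it as a cylinder along `yᵢ` is the substitution `yᵢ ↦ 0`. -/
theorem stub_sliceCyl : ∀ (k : Type) [Field k] (n : ℕ) (i : Fin n) (g : MvPowerSeries (Fin (n + 1)) k),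
    MvPowerSeries.subst (fun m : Fin n => (MvPowerSeries.X ((Fin.succ i).succAbove m) : MvPowerSeries (Fin (n + 1)) k))
      (MvPowerSeries.subst (fun j : Fin (n + 1) => if j = i.succ then (0 : MvPowerSeries (Fin n) k)
        else MvPowerSeries.X (Fin.predAbove i j)) g) =
    MvPowerSeries.subst (fun j : Fin (n + 1) => if j = i.succ then (0 : MvPowerSeries (Fin (n + 1)) k)
      else MvPowerSeries.X j) g := by
  sorry

/-- TAME SLICE, transport form (Luna's étale slice on `B₊` at a point with `cᵢ ≠ 0`, given a `wᵢ`-th root `r` of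
`1 + yᵢ/cᵢ`): the successor `g` is a unit times a formal coordinate change of `g|_{yᵢ = 0}`.  (Torus reparametrisation
`s ↦ r⁻¹s`, `yⱼ ↦ r^{wⱼ}(cⱼ+yⱼ) − cⱼ` fixes the chart off `i` and kills `yᵢ` in the `i`-th chart entry; then invert it.) -/
theorem stub_tameSliceKappa : ∀ (k : Type) [Field k] (n : ℕ) (F : MvPowerSeries (Fin n) k) (w : Fin n → ℕ)
    (c : Fin n → k), (∀ i, w i = 0 → c i = 0) → ∀ (a : ℕ) (g : MvPowerSeries (Fin (n + 1)) k),
    MvPowerSeries.subst (CobordantChart.chart w c) F = MvPowerSeries.X 0 ^ a * g →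
    ∀ (i : Fin n), c i ≠ 0 → ∀ (r : MvPowerSeries (Fin (n + 1)) k), MvPowerSeries.constantCoeff r = 1 →
    r ^ (w i) = 1 + MvPowerSeries.C (c i)⁻¹ * MvPowerSeries.X i.succ →
    (∀ e : Fin (n + 1) →₀ ℕ, MvPowerSeries.coeff e r ≠ 0 → ∀ l, l ≠ i.succ → e l = 0) →
    ∃ (Φ : Fin (n + 1) → MvPowerSeries (Fin (n + 1)) k) (u : MvPowerSeries (Fin (n + 1)) k),
      (∀ j, MvPowerSeries.constantCoeff (Φ j) = 0) ∧
      IsUnit (Matrix.det (Matrix.of fun j l => MvPowerSeries.coeff (Finsupp.single l 1) (Φ j))) ∧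
      MvPowerSeries.constantCoeff u ≠ 0 ∧
      g = u * MvPowerSeries.subst Φ (MvPowerSeries.subst
        (fun j : Fin (n + 1) => if j = i.succ then (0 : MvPowerSeries (Fin (n + 1)) k) else MvPowerSeries.X j) g) := by
  sorry

/-- HORNED RANK (hardest stub; the line's transfer `C⁺`).  One ordinal rank on formal germs in all embedding
dimensions, monotone under coordinate changes / units / cylinders, which after some weighted cobordant move drops at
every off-vertex singular successor: on the flat slice at a tame coordinate, on the graded honest successor at wild
points. -/
theorem stub_hornedRank : ∀ (p : ℕ), p.Prime → ∀ (k : Type) [Field k] [CharP k p] [IsAlgClosed k],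
    ∃ ρ : (n : ℕ) → MvPowerSeries (Fin n) k → Ordinal.{0},
    (∀ (n : ℕ) (f : MvPowerSeries (Fin n) k) (Φ : Fin n → MvPowerSeries (Fin n) k),
      (∀ i, MvPowerSeries.constantCoeff (Φ i) = 0) →
      IsUnit (Matrix.det (Matrix.of fun i j => MvPowerSeries.coeff (Finsupp.single j 1) (Φ i))) →
      ρ n (MvPowerSeries.subst Φ f) ≤ ρ n f) ∧
    (∀ (n : ℕ) (f u : MvPowerSeries (Fin n) k), MvPowerSeries.constantCoeff u ≠ 0 → ρ n (u * f) ≤ ρ n f) ∧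
    (∀ (n : ℕ) (j : Fin (n + 1)) (h : MvPowerSeries (Fin n) k),
      ρ (n + 1) (MvPowerSeries.subst (fun m : Fin n => (MvPowerSeries.X (j.succAbove m) : MvPowerSeries (Fin (n + 1)) k)) h)
        ≤ ρ n h) ∧
    ∀ (n : ℕ) (f : MvPowerSeries (Fin n) k),
      (f ≠ 0 ∧ MvPowerSeries.constantCoeff f = 0 ∧ ∀ i, MvPowerSeries.coeff (Finsupp.single i 1) f = 0) →
      ∃ (θ : Fin n → MvPowerSeries (Fin n) k) (w : Fin n → ℕ),
        (∀ i, MvPowerSeries.constantCoeff (θ i) = 0) ∧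
        IsUnit (Matrix.det (Matrix.of fun i j => MvPowerSeries.coeff (Finsupp.single j 1) (θ i))) ∧
        (∃ i, 0 < w i) ∧
        ∀ (c : Fin n → k), (∀ i, w i = 0 → c i = 0) → c ≠ 0 →
        ∀ (a : ℕ) (g : MvPowerSeries (Fin (n + 1)) k),
          MvPowerSeries.subst (CobordantChart.chart w c) (MvPowerSeries.subst θ f) = MvPowerSeries.X 0 ^ a * g →
          ¬ (MvPowerSeries.X (0 : Fin (n + 1)) ∣ g) →
          (MvPowerSeries.constantCoeff g = 0 ∧ ∀ j, MvPowerSeries.coeff (Finsupp.single j 1) g = 0) →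
          (∀ D : ℕ, (∀ i, c i ≠ 0 → D ∣ w i) → ∀ e : Fin (n + 1) →₀ ℕ, MvPowerSeries.coeff e g ≠ 0 →
            Finsupp.weight w (Finsupp.tail e) ≡ a + e 0 [MOD D]) →
          ((∃ i : Fin n, c i ≠ 0 ∧ ¬ (p ∣ w i) ∧
              ρ n (MvPowerSeries.subst (fun j : Fin (n + 1) => if j = i.succ then (0 : MvPowerSeries (Fin n) k)
                else MvPowerSeries.X (Fin.predAbove i j)) g) < ρ n f) ∨
            ((∀ i : Fin n, c i ≠ 0 → p ∣ w i) ∧ ρ (n + 1) g < ρ n f)) := by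
  sorry

/-! ## Sorry-free glue -/

/-- The planner's TAME SLICE stub in its filed form, derived from `stub_unitRoot`, `stub_tameSliceKappa` and
`stub_sliceCyl`: at an exceptional point with `cᵢ ≠ 0` and `p ∤ wᵢ` the `s`-saturated successor `g` is a unit times a
formal coordinate change of the cylinder over its `n`-variable flat slice `g|_{yᵢ = 0}`. -/
theorem tameSlice : ∀ (p : ℕ), p.Prime → ∀ (k : Type) [Field k] [CharP k p] (n : ℕ) (F : MvPowerSeries (Fin n) k)
    (w : Fin n → ℕ) (c : Fin n → k), (∀ i, w i = 0 → c i = 0) → ∀ (a : ℕ) (g : MvPowerSeries (Fin (n + 1)) k),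
    MvPowerSeries.subst (CobordantChart.chart w c) F = MvPowerSeries.X 0 ^ a * g → ∀ i : Fin n, c i ≠ 0 → ¬ (p ∣ w i) →
    ∃ (Φ : Fin (n + 1) → MvPowerSeries (Fin (n + 1)) k) (u : MvPowerSeries (Fin (n + 1)) k),
      (∀ j, MvPowerSeries.constantCoeff (Φ j) = 0) ∧
      IsUnit (Matrix.det (Matrix.of fun j l => MvPowerSeries.coeff (Finsupp.single l 1) (Φ j))) ∧
      MvPowerSeries.constantCoeff u ≠ 0 ∧
      g = u * MvPowerSeries.subst Φ (MvPowerSeries.subst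
        (fun m : Fin n => (MvPowerSeries.X ((Fin.succ i).succAbove m) : MvPowerSeries (Fin (n + 1)) k))
        (MvPowerSeries.subst (fun j : Fin (n + 1) => if j = i.succ then (0 : MvPowerSeries (Fin n) k)
          else MvPowerSeries.X (Fin.predAbove i j)) g)) := by
  intro p hp k _ _ n F w c hc a g hfac i hci hpw
  have hm : ((w i : ℕ) : k) ≠ 0 := by
    intro h
    exact hpw ((CharP.cast_eq_zero_iff k p (w i)).mp h)
  obtain ⟨r, hr1, hrw, hrsupp⟩ := stub_unitRoot k n i.succ (w i) hm (c i) hci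
  obtain ⟨Φ, u, hΦ0, hΦdet, hu, hg⟩ := stub_tameSliceKappa k n F w c hc a g hfac i hci r hr1 hrw hrsupp
  refine ⟨Φ, u, hΦ0, hΦdet, hu, ?_⟩
  rw [stub_sliceCyl k n i g]
  exact hg

/-- THE COMPOSITION: the line closes the crux `LocalWeightedDrop` BY NAME, modulo the registered stubs.  `ι := ρ` of
`stub_hornedRank`; the crux's literal chart is `CobordantChart.chart w c'` with `c'` the crux-convention point
(`cruxChart_eq_chart`); the grading hypothesis is `stub_gradingDescent`; the tame branch is closed by `tameSlice` and the
three monotonicities of `ρ`, the wild branch is the stub's drop itself. -/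
theorem LocalWeightedDrop_of :
    Summit.ResolutionOfSingularities.ResolutionOfSingularities.Theses.WeightedInvariant.LocalWeightedDrop := by
  intro p hp k _ _ _
  obtain ⟨ρ, hAut, hUnit, hCyl, hMove⟩ := stub_hornedRank p hp k
  refine ⟨ρ, ?_⟩
  intro n f hf
  obtain ⟨θ, w, hθ0, hθdet, hwpos, hdrop⟩ := hMove n f hf
  refine ⟨θ, w, hθ0, hθdet, hwpos, ?_⟩
  intro c hc a g hfac hndvd hsing
  -- the crux-convention point
  set c' : Fin n → k := fun i => if 0 < w i then c i else 0 with hc'def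
  have hconv : ∀ i, w i = 0 → c' i = 0 := by
    intro i hi
    simp [hc'def, hi]
  have hne : c' ≠ 0 := by
    obtain ⟨i, hwi, hci⟩ := hc
    intro h
    have := congrFun h i
    simp [hc'def, hwi] at this
    exact hci this
  have hchart := CobordantChart.cruxChart_eq_chart (k := k) w c
  rw [hchart] at hfac
  have hgrad := stub_gradingDescent k n (MvPowerSeries.subst θ f) w c' hconv a g hfac
  rcases hdrop c' hconv hne a g hfac hndvd hsing hgrad with ⟨i, hci, hpw, hlt⟩ | ⟨-, hlt⟩
  · -- tame point: slice drop, carried up to `g` by the tame slice and the monotonicities of `ρ`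
    obtain ⟨Φ, u, hΦ0, hΦdet, hu, hg⟩ :=
      tameSlice p hp k n (MvPowerSeries.subst θ f) w c' hconv a g hfac i hci hpw
    calc ρ (n + 1) g
        = ρ (n + 1) (u * MvPowerSeries.subst Φ (MvPowerSeries.subst
            (fun m : Fin n => (MvPowerSeries.X ((Fin.succ i).succAbove m) : MvPowerSeries (Fin (n + 1)) k))
            (MvPowerSeries.subst (fun j : Fin (n + 1) => if j = i.succ then (0 : MvPowerSeries (Fin n) k)
              else MvPowerSeries.X (Fin.predAbove i j)) g))) := by rw [← hg]
      _ ≤ ρ (n + 1) (MvPowerSeries.subst Φ (MvPowerSeries.subst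
            (fun m : Fin n => (MvPowerSeries.X ((Fin.succ i).succAbove m) : MvPowerSeries (Fin (n + 1)) k))
            (MvPowerSeries.subst (fun j : Fin (n + 1) => if j = i.succ then (0 : MvPowerSeries (Fin n) k)
              else MvPowerSeries.X (Fin.predAbove i j)) g))) := hUnit _ _ _ hu
      _ ≤ ρ (n + 1) (MvPowerSeries.subst
            (fun m : Fin n => (MvPowerSeries.X ((Fin.succ i).succAbove m) : MvPowerSeries (Fin (n + 1)) k))
            (MvPowerSeries.subst (fun j : Fin (n + 1) => if j = i.succ then (0 : MvPowerSeries (Fin n) k)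
              else MvPowerSeries.X (Fin.predAbove i j)) g)) := hAut _ _ Φ hΦ0 hΦdet
      _ ≤ ρ n (MvPowerSeries.subst (fun j : Fin (n + 1) => if j = i.succ then (0 : MvPowerSeries (Fin n) k)
              else MvPowerSeries.X (Fin.predAbove i j)) g) := hCyl n i.succ _
      _ < ρ n f := hlt
  · -- wild point: the stub's drop on the honest successor
    exact hlt

end Summit.ResolutionOfSingularities.ResolutionOfSingularities.Theorems.LocalWeightedDropLine

#h21_check_skeleton "stmt-ResolutionOfSingularities-8899" Summit.ResolutionOfSingularities.ResolutionOfSingularities.Theses.WeightedInvariant.LocalWeightedDrop stub_gradingDescent stub_unitRoot stub_sliceCyl stub_tameSliceKappa stub_hornedRank
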